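import Summits.QuantumFields.QCD.Theorems.CentreStabilisedCircleCFCCentreStabilitySeamTwist
import Literature.MathematicalPhysics.QuantumLattice.GrassmannIntegralSubstitution
import Literature.MathematicalPhysics.QuantumLattice.GrassmannGaussianSymmetry

/-!
# The `ℤ₃` colour-flavour-centre (CFC) symmetry of the centre-stabilised, flavour-twisted slab
# functional, II: the selection rule and `⟨tr P⟩ = 0` in every finite volume

Helper file for item stmt-QuantumFields-10528 (`CFCCentreStability`, route
`CentreStabilisedCircle`, sub-problem `QCD` of `QuantumFields`).  The item's informal statement
asserts that on the mass-degenerate `N_f = 3` line with flavour-twisted temporal boundary phases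
`θ_f = θ̄ + 2πf/3` "the `ℤ₃` colour-flavour-centre symmetry is EXACT and `⟨tr P⟩ = 0` in every
finite volume", so that the Polyakov-loop two-point function of the item is its own connected
correlator.  This file proves exactly that for the tree's functional `qcdCirclePartition` /
`qcdCircleExpect` (`QCDSlabFunctional.lean`), at every `N_t, N_s ≥ 1`, every `β`, every
deformation strength `h`, every common bare mass `m` and every offset `θ̄`:

* `qcdCircleDirac_flavourShift` — at a common bare mass, shifting the twists cyclically through
  the flavours (`θ_f ↦ θ_{f+1}` as phases) is conjugation of the twisted Wilson–Dirac matrix by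
  the induced relabelling of the quark variables;
* `berezin_scalar_mul_grassmannExp_quadratic_submatrix` — the Gaussian Berezin integral with a
  scalar insertion is invariant under a permutation relabelling of the variables (Jacobian
  `sign² = 1`; from the tree's `map_blockSubst_quadratic` and `berezin_map`);
* `qcdCirclePartition_eq_zero_of_cfc_covariant` — **selection rule**: a scalar gauge functional
  `O` with `O(c·U) = κ O(U)` under the seam twist, `κ ≠ 1`, has `Z(O) = 0`;
* `qcdCirclePartition_polyakovTrace_eq_zero`, `qcdCircleExpect_polyakovTrace_eq_zero` —
  `Z(tr P_x⃗) = 0` and `⟨tr P_x⃗⟩ = 0` (charge `ζ = e^{2πi/3}`; no hypothesis `Z(1) ≠ 0` needed),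
  and the conjugate versions (charge `ζ⁻¹`).

## Proof

With Part I (`…SeamTwist.lean`): substitute `U ↦ c·U` in `Z(O) = ∫ Φ(U) dU` (left invariance
of the product Haar measure `Measure.pi`); the gauge weights are invariant, the fermion factor
`∫dψ̄dψ e^{−ψ̄ D(c·U) ψ}` equals the one at `U` because the twist shift by `2π/3` is the cyclic
flavour shift, a relabelling of the quark variables; hence `Z(O) = κ Z(O)` and `Z(O) = 0`.
[KounoEtAl2012 §II; RobergeWeiss1986]

Pure theorem file, no definitions and no notation.
-/

noncomputable section

namespace Summit.QuantumFields.QCD.Theorems.CentreStabilisedCircleCFC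

open Literature.MathematicalPhysics.QuantumLattice Literature.MathematicalPhysics.QuantumFieldTheory
open MeasureTheory
open scoped Matrix

variable {Nt Ns : ℕ}

/-! ### The cyclic flavour shift -/

/-- The cyclic flavour shift `f ↦ f + 1`, transported to the enumerated quark variables
(`circleQuarkEquiv ∘ (· + 1) × id ∘ circleQuarkEquiv⁻¹`), on an enumerated variable. -/
theorem flavourShift_apply [NeZero Nt] [NeZero Ns] (v : CircleQuarkVar 3 Nt Ns) :
    ((circleQuarkEquiv (Nf := 3) (Nt := Nt) (Ns := Ns)).symm.trans
        ((Equiv.prodCongr (Equiv.addRight (1 : Fin 3)) (Equiv.refl _)).trans circleQuarkEquiv))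
      (circleQuarkEquiv v) = circleQuarkEquiv (v.1 + 1, v.2) := by
  simp [Prod.map]

/-- **Flavour-shift covariance of the degenerate twisted Dirac matrix**: if the twists `θ'` are
the twists `θ` read through the cyclic flavour shift `f ↦ f + 1` (as phases), then at a common
bare mass `D(U; m, θ')` is `D(U; m, θ)` conjugated by the induced relabelling of the quark
variables. -/
theorem qcdCircleDirac_flavourShift [NeZero Nt] [NeZero Ns] (U : QCDCircleConfig Nt Ns) (m : ℝ)
    (θ θ' : Fin 3 → ℝ)
    (hθ : ∀ (f : Fin 3) (μ : SlabGauge.Dir 3) (s : SlabGauge.Site 3 Nt Ns),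
      flavourTwistPhase (θ' f) μ s = flavourTwistPhase (θ (f + 1)) μ s) :
    qcdCircleDirac U (fun _ => m) θ' =
      (qcdCircleDirac U (fun _ => m) θ).submatrix
        ((circleQuarkEquiv (Nf := 3) (Nt := Nt) (Ns := Ns)).symm.trans
          ((Equiv.prodCongr (Equiv.addRight (1 : Fin 3)) (Equiv.refl _)).trans circleQuarkEquiv))
        ((circleQuarkEquiv (Nf := 3) (Nt := Nt) (Ns := Ns)).symm.trans
          ((Equiv.prodCongr (Equiv.addRight (1 : Fin 3)) (Equiv.refl _)).trans circleQuarkEquiv)) := by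
  ext i j
  obtain ⟨v, rfl⟩ := circleQuarkEquiv.surjective i
  obtain ⟨w, rfl⟩ := circleQuarkEquiv.surjective j
  rw [Matrix.submatrix_apply, flavourShift_apply, flavourShift_apply]
  simp only [qcdCircleDirac, Matrix.reindex_apply, Matrix.submatrix_apply, Equiv.symm_apply_apply,
    Matrix.of_apply, hθ, add_left_inj]

/-! ### Berezin integrals are invariant under a relabelling of the quark variables -/

/-- **Relabelling invariance of the Gaussian Berezin integral with a scalar insertion**: for a
permutation `π` of the variables, `∫dψ̄dψ a·e^{ψ̄ A_{π,π} ψ} = ∫dψ̄dψ a·e^{ψ̄ A ψ}` (the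
substitution `ψ̄ᵢ ↦ ψ̄_{πi}`, `ψᵢ ↦ ψ_{πi}` has Jacobian `sign(π)² = 1`). -/
theorem berezin_scalar_mul_grassmannExp_quadratic_submatrix {ι : Type*} [LinearOrder ι]
    [Fintype ι] (A : Matrix ι ι ℂ) (π : Equiv.Perm ι) (a : ℂ) :
    GrassmannAlgebra.berezin ℂ (ι ⊕ₗ ι)
        (algebraMap ℂ _ a * grassmannExp (quadratic ℂ (A.submatrix π π))) =
      GrassmannAlgebra.berezin ℂ (ι ⊕ₗ ι) (algebraMap ℂ _ a * grassmannExp (quadratic ℂ A)) := by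
  set P : Matrix ι ι ℂ := π.toPEquiv.toMatrix with hPdef
  have hT : Pᵀ = (π.symm.toPEquiv.toMatrix : Matrix ι ι ℂ) := by
    rw [hPdef, Equiv.toPEquiv_symm, PEquiv.toMatrix_symm]
  have hP : P * A * Pᵀ = A.submatrix π π := by
    rw [hPdef, PEquiv.toMatrix_toPEquiv_mul, ← hPdef, hT, PEquiv.mul_toMatrix_toPEquiv]
    ext i j
    simp
  have hdet : P.det * P.det = 1 := by
    rw [hPdef, Matrix.det_permutation, ← Int.cast_mul, ← Units.val_mul, Int.units_mul_self,
      Units.val_one, Int.cast_one]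
  calc GrassmannAlgebra.berezin ℂ (ι ⊕ₗ ι)
        (algebraMap ℂ _ a * grassmannExp (quadratic ℂ (A.submatrix π π)))
      = GrassmannAlgebra.berezin ℂ (ι ⊕ₗ ι) (ExteriorAlgebra.map (blockSubst ℂ P P)
          (algebraMap ℂ _ a * grassmannExp (quadratic ℂ A))) := by
        congr 1
        rw [map_mul (ExteriorAlgebra.map (blockSubst ℂ P P)), AlgHom.commutes,
          map_blockSubst_grassmannExp_quadratic, hP]
    _ = GrassmannAlgebra.berezin ℂ (ι ⊕ₗ ι) (algebraMap ℂ _ a * grassmannExp (quadratic ℂ A)) := by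
        rw [GrassmannAlgebra.berezin_map, det_blockSubst, hdet, one_mul]

/-! ### The `ℤ₃` colour-flavour-centre selection rule -/

/-- A real angle shifted by an integer multiple of `2π` gives the same phase. -/
theorem exp_ofReal_mul_I_eq_of_int (a b : ℝ) (k : ℤ) (h : a = b + 2 * Real.pi * k) :
    Complex.exp ((a : ℂ) * Complex.I) = Complex.exp ((b : ℂ) * Complex.I) :=
  Complex.exp_eq_exp_iff_exists_int.2 ⟨k, by rw [h]; push_cast; ring⟩

/-- **The CFC twists are shifted cyclically by the seam twist**: adding `2π/3` to
`θ_f = θ̄ + 2πf/3` gives the phase of `θ_{f+1}` (for `f = 2` up to the period `2π`). -/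
theorem flavourTwistPhase_cfc_shift (θb : ℝ) (f : Fin 3) (μ : SlabGauge.Dir 3)
    (s : SlabGauge.Site 3 Nt Ns) :
    flavourTwistPhase (θb + 2 * Real.pi * (f : ℝ) / 3 + 2 * Real.pi / 3) μ s =
      flavourTwistPhase (θb + 2 * Real.pi * ((f + 1 : Fin 3) : ℝ) / 3) μ s := by
  unfold flavourTwistPhase
  split_ifs
  · fin_cases f
    · exact exp_ofReal_mul_I_eq_of_int _ _ 0 (by simp)
    · exact exp_ofReal_mul_I_eq_of_int _ _ 0 (by simp; ring)
    · exact exp_ofReal_mul_I_eq_of_int _ _ 1 (by simp; ring)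
  · rfl

section Seam

variable {z : Matrix.specialUnitaryGroup (Fin 3) ℂ} {c : QCDCircleConfig Nt Ns}

/-- **Covariance of the Boltzmann–Berezin integrand under the seam twist** on the degenerate,
CFC-twisted line: for a scalar gauge functional `O`, the integrand of `Z(O)` at `c·U` is the
integrand of `Z(O ∘ (c·))` at `U` — the gauge weights are invariant and the fermion factor is
invariant (twist shift = flavour shift = relabelling of quark variables). -/
theorem cfc_integrand_seam_mul [NeZero Nt] [NeZero Ns]
    (hz : (z : Matrix (Fin 3) (Fin 3) ℂ) =
      Complex.exp (((2 * Real.pi / 3 : ℝ) : ℂ) * Complex.I) • (1 : Matrix (Fin 3) (Fin 3) ℂ))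
    (hc : ∀ l, c l = if l.2 = none ∧ l.1.1 = -1 then z else 1) (β h m θb : ℝ)
    (O : QCDCircleConfig Nt Ns → ℂ) (U : QCDCircleConfig Nt Ns) :
    GrassmannAlgebra.berezin ℂ _
        (algebraMap ℂ (CircleFermiAlg 3 Nt Ns) (O (c * U)) *
          grassmannExp (quadratic ℂ (-qcdCircleDirac (c * U) (fun _ => m)
            (fun f => θb + 2 * Real.pi * (f : ℝ) / 3)))) *
      ((SlabGauge.weight (fundamentalRep (Fin 3)) β β (c * U) *
          polyakovDeformationWeight h (c * U) : ℝ) : ℂ) =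
    GrassmannAlgebra.berezin ℂ _
        (algebraMap ℂ (CircleFermiAlg 3 Nt Ns) (O (c * U)) *
          grassmannExp (quadratic ℂ (-qcdCircleDirac U (fun _ => m)
            (fun f => θb + 2 * Real.pi * (f : ℝ) / 3)))) *
      ((SlabGauge.weight (fundamentalRep (Fin 3)) β β U * polyakovDeformationWeight h U : ℝ) : ℂ) := by
  rw [weight_seam_mul hz hc, polyakovDeformationWeight_seam_mul hz hc, qcdCircleDirac_seam_mul hz hc,
    qcdCircleDirac_flavourShift U m (fun f => θb + 2 * Real.pi * (f : ℝ) / 3)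
      (fun f => θb + 2 * Real.pi * (f : ℝ) / 3 + 2 * Real.pi / 3)
      (fun f μ s => flavourTwistPhase_cfc_shift θb f μ s)]
  have hneg : ∀ (D : Matrix (CircleFermiIdx 3 Nt Ns) (CircleFermiIdx 3 Nt Ns) ℂ)
      (e : CircleFermiIdx 3 Nt Ns → CircleFermiIdx 3 Nt Ns), -(D.submatrix e e) = (-D).submatrix e e :=
    fun D e => rfl
  rw [hneg, berezin_scalar_mul_grassmannExp_quadratic_submatrix]

/-- **`ℤ₃` colour-flavour-centre selection rule.** On the mass-degenerate three-flavour line with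
twists `θ_f = θ̄ + 2πf/3`, every scalar gauge functional `O` of non-trivial CFC charge —
`O(c·U) = κ O(U)` under the seam twist with `κ ≠ 1` — has vanishing un-normalised functional
`Z(O) = 0`, at every `N_t, N_s ≥ 1`, `β`, `h`, `m`, `θ̄`. -/
theorem qcdCirclePartition_eq_zero_of_cfc_covariant (Nt Ns : ℕ) [NeZero Nt] [NeZero Ns]
    (β h m θb : ℝ) (O : QCDCircleConfig Nt Ns → ℂ) (κ : ℂ) (hκ : κ ≠ 1)
    (hO : ∀ U : QCDCircleConfig Nt Ns,
      O ((fun l => if l.2 = none ∧ l.1.1 = -1 then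
        (⟨Complex.exp (((2 * Real.pi / 3 : ℝ) : ℂ) * Complex.I) • (1 : Matrix (Fin 3) (Fin 3) ℂ),
          zeta_smul_one_mem⟩ : Matrix.specialUnitaryGroup (Fin 3) ℂ) else 1) * U) = κ * O U) :
    qcdCirclePartition (Nf := 3) Nt Ns β h (fun _ => m) (fun f => θb + 2 * Real.pi * (f : ℝ) / 3)
      (fun U => algebraMap ℂ (CircleFermiAlg 3 Nt Ns) (O U)) = 0 := by
  set z : Matrix.specialUnitaryGroup (Fin 3) ℂ :=
    ⟨Complex.exp (((2 * Real.pi / 3 : ℝ) : ℂ) * Complex.I) • (1 : Matrix (Fin 3) (Fin 3) ℂ),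
      zeta_smul_one_mem⟩ with hzdef
  have hz : (z : Matrix (Fin 3) (Fin 3) ℂ) =
      Complex.exp (((2 * Real.pi / 3 : ℝ) : ℂ) * Complex.I) • (1 : Matrix (Fin 3) (Fin 3) ℂ) := rfl
  set c : QCDCircleConfig Nt Ns := fun l => if l.2 = none ∧ l.1.1 = -1 then z else 1 with hcdef
  have hc : ∀ l, c l = if l.2 = none ∧ l.1.1 = -1 then z else 1 := fun l => rfl
  haveI : (haarProbability (Matrix.specialUnitaryGroup (Fin 3) ℂ)).IsMulLeftInvariant := by
    unfold haarProbability; infer_instance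
  haveI : (SlabGauge.haar 3 Nt Ns (Matrix.specialUnitaryGroup (Fin 3) ℂ)).IsMulLeftInvariant := by
    unfold SlabGauge.haar; infer_instance
  unfold qcdCirclePartition
  set Φ : QCDCircleConfig Nt Ns → ℂ := fun U =>
    GrassmannAlgebra.berezin ℂ _
        (algebraMap ℂ (CircleFermiAlg 3 Nt Ns) (O U) *
          grassmannExp (quadratic ℂ (-qcdCircleDirac U (fun _ => m)
            (fun f => θb + 2 * Real.pi * (f : ℝ) / 3)))) *
      ((SlabGauge.weight (fundamentalRep (Fin 3)) β β U * polyakovDeformationWeight h U : ℝ) : ℂ)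
    with hΦ
  have hcov : ∀ U, Φ (c * U) = κ * Φ U := fun U => by
    simp only [hΦ]
    rw [cfc_integrand_seam_mul hz hc β h m θb O U, hO U, map_mul (algebraMap ℂ (CircleFermiAlg 3 Nt Ns)),
      mul_assoc, ← Algebra.smul_def, LinearMap.map_smul, smul_eq_mul, mul_assoc]
  have key : ∫ U, Φ U ∂(SlabGauge.haar 3 Nt Ns (Matrix.specialUnitaryGroup (Fin 3) ℂ)) = κ * ∫ U, Φ U ∂(SlabGauge.haar 3 Nt Ns (Matrix.specialUnitaryGroup (Fin 3) ℂ)) := by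
    calc ∫ U, Φ U ∂(SlabGauge.haar 3 Nt Ns (Matrix.specialUnitaryGroup (Fin 3) ℂ))
        = ∫ U, Φ (c * U) ∂(SlabGauge.haar 3 Nt Ns (Matrix.specialUnitaryGroup (Fin 3) ℂ)) := (integral_mul_left_eq_self Φ c).symm
      _ = ∫ U, κ * Φ U ∂(SlabGauge.haar 3 Nt Ns (Matrix.specialUnitaryGroup (Fin 3) ℂ)) := by simp only [hcov]
      _ = κ * ∫ U, Φ U ∂(SlabGauge.haar 3 Nt Ns (Matrix.specialUnitaryGroup (Fin 3) ℂ)) := integral_const_mul κ Φ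
  have h1 : (1 - κ) * ∫ U, Φ U ∂(SlabGauge.haar 3 Nt Ns (Matrix.specialUnitaryGroup (Fin 3) ℂ)) = 0 := by
    rw [sub_mul, one_mul, ← key, sub_self]
  rcases mul_eq_zero.1 h1 with h0 | h0
  · exact absurd (sub_eq_zero.1 h0).symm hκ
  · exact h0

/-- **The Polyakov loop has zero un-normalised functional** on the degenerate CFC-twisted line:
`Z(tr P_x⃗) = 0` (charge `e^{2πi/3}`). -/
theorem qcdCirclePartition_polyakovTrace_eq_zero (Nt Ns : ℕ) [NeZero Nt] [NeZero Ns]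
    (β h m θb : ℝ) (x : Fin 3 → ZMod Ns) :
    qcdCirclePartition (Nf := 3) Nt Ns β h (fun _ => m) (fun f => θb + 2 * Real.pi * (f : ℝ) / 3)
      (fun U => algebraMap ℂ (CircleFermiAlg 3 Nt Ns)
        (SlabGauge.polyakovTrace (fundamentalRep (Fin 3)) U x)) = 0 :=
  qcdCirclePartition_eq_zero_of_cfc_covariant Nt Ns β h m θb _ _ zeta_ne_one
    fun U => polyakovTrace_seam_mul rfl (fun _ => rfl) U x

/-- `conj ζ ≠ 1`. -/
theorem conj_zeta_ne_one :
    (starRingEnd ℂ) (Complex.exp (((2 * Real.pi / 3 : ℝ) : ℂ) * Complex.I)) ≠ 1 := fun h =>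
  zeta_ne_one (by simpa using congrArg (starRingEnd ℂ) h)

/-- **The conjugate Polyakov loop has zero un-normalised functional** on the degenerate
CFC-twisted line: `Z(conj tr P_x⃗) = 0` (charge `e^{−2πi/3}`). -/
theorem qcdCirclePartition_conj_polyakovTrace_eq_zero (Nt Ns : ℕ) [NeZero Nt] [NeZero Ns]
    (β h m θb : ℝ) (x : Fin 3 → ZMod Ns) :
    qcdCirclePartition (Nf := 3) Nt Ns β h (fun _ => m) (fun f => θb + 2 * Real.pi * (f : ℝ) / 3)
      (fun U => algebraMap ℂ (CircleFermiAlg 3 Nt Ns)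
        ((starRingEnd ℂ) (SlabGauge.polyakovTrace (fundamentalRep (Fin 3)) U x))) = 0 :=
  qcdCirclePartition_eq_zero_of_cfc_covariant Nt Ns β h m θb _ _ conj_zeta_ne_one
    fun U => by rw [polyakovTrace_seam_mul rfl (fun _ => rfl) U x, map_mul]

/-- **`⟨tr P_x⃗⟩ = 0` in every finite volume** (exact `ℤ₃` colour-flavour-centre symmetry; no
hypothesis on `Z(1)`): the expectation `qcdCircleExpect` of the traced Polyakov loop vanishes on
the mass-degenerate three-flavour line with twists `θ_f = θ̄ + 2πf/3`, for every `N_t, N_s ≥ 1`,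
every `β`, every deformation strength `h`, every common bare mass `m` and every `θ̄`. This is the
"`⟨tr P⟩ = 0` in every finite volume" clause of item stmt-QuantumFields-10528
(`CFCCentreStability`): the item's Polyakov-loop two-point function is its own connected
correlator. -/
theorem qcdCircleExpect_polyakovTrace_eq_zero (Nt Ns : ℕ) [NeZero Nt] [NeZero Ns]
    (β h m θb : ℝ) (x : Fin 3 → ZMod Ns) :
    qcdCircleExpect (Nf := 3) Nt Ns β h (fun _ => m) (fun f => θb + 2 * Real.pi * (f : ℝ) / 3)
      (fun U => algebraMap ℂ (CircleFermiAlg 3 Nt Ns)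
        (SlabGauge.polyakovTrace (fundamentalRep (Fin 3)) U x)) = 0 := by
  rw [qcdCircleExpect, qcdCirclePartition_polyakovTrace_eq_zero, zero_div]

/-- `⟨conj tr P_x⃗⟩ = 0` in every finite volume, likewise. -/
theorem qcdCircleExpect_conj_polyakovTrace_eq_zero (Nt Ns : ℕ) [NeZero Nt] [NeZero Ns]
    (β h m θb : ℝ) (x : Fin 3 → ZMod Ns) :
    qcdCircleExpect (Nf := 3) Nt Ns β h (fun _ => m) (fun f => θb + 2 * Real.pi * (f : ℝ) / 3)
      (fun U => algebraMap ℂ (CircleFermiAlg 3 Nt Ns)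
        ((starRingEnd ℂ) (SlabGauge.polyakovTrace (fundamentalRep (Fin 3)) U x))) = 0 := by
  rw [qcdCircleExpect, qcdCirclePartition_conj_polyakovTrace_eq_zero, zero_div]

end Seam
end Summit.QuantumFields.QCD.Theorems.CentreStabilisedCircleCFC

end
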